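import Literature.NumberTheory.EllipticCurves.ShintaniKernelLevel64
import Literature.NumberTheory.EllipticCurves.ShintaniConeGaussSums
import HarnessLib

/-!
# The twisted Shintani kernel `K_D` of level `64` and its Poisson step

[[cite: Shintani1975, §1 Prop. 1.6, §2 (2.1)]] — for an odd square-free `D` the kernel
`K_D(w, z) = (Im z)^{1/2} ∑_{v ∈ ℤ³} ω_D(v) f_{w, z/(256D)}(ι v)`, `ι v = (64v₀, 128v₁, v₂)` the
coefficient lattice `L` of the forms `64aX² + 128bXY + cY²`, weighted by the genus character
`ω_D` (`ShintaniGenusSymbols`), is the `D`-th theta kernel of the level-`64` Shintani lift used in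
route K64 towards the Waldspurger-type relation behind `tunnell_converse_even`.  This file:

* `cD`, `kerD` — the weight on `L♮ ⊇ L` and the kernel as a `genKernel` (`ShintaniKernelLevel64`);
  `Γ₀(64)`-invariance of the weight (`invWeight_cD`), `K_D ≡ 0` for `D ≡ 3 (mod 4)` (oddness);
* **the Poisson step** `kerD_smul`: for `γ = (a b; c d) ∈ SL₂(ℤ)`, `c > 0`, `4 ∣ c`, `N = cD`,
  `K_D(w, γz) = (Im γz)^{1/2} (8192N³)⁻¹ κ(Z') (128N)⁻¹ ∑_k 𝔊_γ(k) f_{w, z/(256D)}(ι♮ k)` with the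
  Gauss coefficients `𝔊_γ(k) = e(d·disc ι♮k/(256N)) ∑_{r mod N} ω_D(r) ψ_N(a n(r) + ℓ(r,k))`
  (split `v = Nq + r`, Poisson over `diag(64N,128N,N)ℤ³ + ι(r)` via `tsum_shintaniFn_diag`, the point
  identity `γz/(256D) = a/(256Dc) − 1/(256N(cz+d))`, homogeneity `f(λx) = λ³…` in the form
  `shintaniFn_ptD_smul`, and the swap of the finite `r`-sum with the `k`-series);
* **the evaluation at `c = 256`** (`kerD_smul_sigma`): by `ShintaniConeGaussSums` the Gauss
  coefficient vanishes off `L` and equals `𝒦(a,a*) ω_D(v)` on `L` (`gaussCoef_embedSharp`), so the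
  kernel reproduces itself up to the constant `(8192N³)⁻¹ κ(Z') (128N)⁻¹ 𝒦(a, a*) (Im z)^{-1/2}`.

The constant is matched with `(θ(σz)/θ(z))³` in `ShintaniKernelLevel256Law`.  Everything is
proved; no facts are introduced.
-/

noncomputable section

open Complex Real
open scoped MatrixGroups

namespace Literature.NumberTheory.EllipticCurves.Shintani

open UpperHalfPlane hiding I

/-- Products of `NeZero` naturals are `NeZero` (instance used for the moduli `N = cD`). [folklore] -/
instance instNeZeroMulNat (a b : ℕ) [NeZero a] [NeZero b] : NeZero (a * b) :=
  ⟨mul_ne_zero (NeZero.ne a) (NeZero.ne b)⟩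

/-! ### The weight `c_D` on `L♮` and the kernel `K_D` -/

/-- The weight of the `D`-th kernel on `L♮`-coordinates: `ω_D` on the sublattice `L = {128 ∣ k₁}`,
`0` elsewhere. [folklore] -/
def cD (D : ℕ) (k : Fin 3 → ℤ) : ℂ :=
  if (128 : ℤ) ∣ k 1 then (genusWt D ![k 0, k 1 / 128, k 2] : ℂ) else 0

/-- `cD_embedSharp` (auxiliary). [folklore] -/
theorem cD_embedSharp (D : ℕ) (v : Fin 3 → ℤ) : cD D (embedSharp v) = genusWt D v := by
  unfold cD
  rw [if_pos (by simp : (128 : ℤ) ∣ embedSharp v 1)]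
  congr 1
  congr 1
  funext i
  fin_cases i <;> simp

/-- `cD_of_not_dvd` (auxiliary). [folklore] -/
theorem cD_of_not_dvd {D : ℕ} {k : Fin 3 → ℤ} (h : ¬ (128 : ℤ) ∣ k 1) : cD D k = 0 := by
  simp [cD, h]

/-- `bddWeight_cD` (auxiliary). [folklore] -/
theorem bddWeight_cD (D : ℕ) : BddWeight (cD D) := by
  refine ⟨1, fun k ↦ ?_⟩
  unfold cD
  split_ifs
  · rw [Complex.norm_intCast]
    exact_mod_cast abs_genusWt_le D _
  · simp

/-- `k ∈ L` iff after the action it is: `128 ∣ (actSharp g k)₁ ↔ 128 ∣ k₁` (for `ad - 64bc' = 1`). [folklore] -/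
theorem dvd_actSharp_one_iff {a b c' d : ℤ} (hdet : a * d - 64 * b * c' = 1) (k : Fin 3 → ℤ) :
    (128 : ℤ) ∣ actSharp a b c' d k 1 ↔ (128 : ℤ) ∣ k 1 := by
  have e : actSharp a b c' d k 1 = k 1 + 128 * (k 0 * a * b + k 1 * b * c' + k 2 * c' * d) := by
    simp only [actSharp, Matrix.cons_val_one, Matrix.cons_val_zero]
    linear_combination k 1 * hdet
  rw [e]
  exact dvd_add_left (dvd_mul_right 128 _)

/-- The two coordinate actions agree on `L`: `actSharp g (embed v) = embed (actInt g v)`. [folklore] -/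
theorem actSharp_embedSharp (a b c' d : ℤ) (v : Fin 3 → ℤ) :
    actSharp a b c' d (embedSharp v) = embedSharp (actInt a b c' d v) := by
  funext i
  fin_cases i <;> simp [actSharp, embedSharp, actInt]
  ring

/-- **`c_D` is `Γ₀(64)`-invariant** (`D` odd). [folklore] -/
theorem invWeight_cD {D : ℕ} (hD : Odd D) : InvWeight (cD D) := by
  intro a b c' d hdet k
  by_cases hk : (128 : ℤ) ∣ k 1
  · obtain ⟨k1, hk1⟩ := hk
    -- `k = embed v` with `v = (k₀, k₁/128, k₂)`
    set v : Fin 3 → ℤ := ![k 0, k1, k 2] with hv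
    have hkv : k = embedSharp v := by
      funext i; fin_cases i <;> simp [hv, embedSharp, hk1]
    rw [hkv, actSharp_embedSharp, cD_embedSharp, cD_embedSharp, genusWt_actInt hD hdet]
  · rw [cD_of_not_dvd hk, cD_of_not_dvd ((dvd_actSharp_one_iff hdet k).not.mpr hk)]

/-- Scale of the `D`-th kernel: `t_D = 1/(256 D)`. [folklore] -/
theorem scaleD_pos (D : ℕ) [NeZero D] : (0 : ℝ) < 1 / (256 * D) := by
  have : (0 : ℝ) < D := by exact_mod_cast Nat.pos_of_ne_zero (NeZero.ne D)
  positivity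

/-- **The `D`-th twisted Shintani theta kernel of level `64`**:
`K_D(w, z) = (Im z)^{1/2} ∑_{k ∈ L♮} c_D(k) f_{w, z/(256D)}(ι♮ k) = (Im z)^{1/2} ∑_{v ∈ ℤ³} ω_D(v) f_{w, z/(256D)}(ι v)`
(Shintani 1975, (2.1) with the lattice `L`, the character `ω_D` and the normalisation `z ↦ z/(256D)`;
Kohnen 1985, §2, the `D`-th kernel). [cite: Shintani1975, §2 (2.1), Thm. 2] -/
def kerD (D : ℕ) [NeZero D] (w z : ℍ) : ℂ := genKernel (cD D) (1 / (256 * D)) (scaleD_pos D) w z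

/-- A series on `L♮` supported on `L` is a series on `L`. [folklore] -/
theorem tsum_cD_mul (D : ℕ) (F : V → ℂ) :
    ∑' k : Fin 3 → ℤ, cD D k * F (latSharp k) = ∑' v : Fin 3 → ℤ, (genusWt D v : ℂ) * F (latFun v) := by
  have hsupp : Function.support (fun k : Fin 3 → ℤ ↦ cD D k * F (latSharp k)) ⊆ Set.range embedSharp := by
    intro k hk
    rw [Function.mem_support] at hk
    by_cases h : (128 : ℤ) ∣ k 1
    · obtain ⟨k1, hk1⟩ := h
      exact ⟨![k 0, k1, k 2], by funext i; fin_cases i <;> simp [embedSharp, hk1]⟩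
    · exact absurd (by rw [cD_of_not_dvd h, zero_mul]) hk
  rw [← tsum_subtype_eq_of_support_subset hsupp]
  rw [← (Equiv.ofInjective embedSharp embedSharp_injective).tsum_eq]
  refine tsum_congr fun v ↦ ?_
  simp only [Equiv.ofInjective_apply]
  rw [cD_embedSharp, latSharp_embedSharp]

/-- **`K_D` in `L`-coordinates**: `K_D(w,z) = (Im z)^{1/2} ∑_v ω_D(v) f_{w, z/(256D)}(ι v)`. [folklore] -/
theorem kerD_eq_tsum (D : ℕ) [NeZero D] (w z : ℍ) :
    kerD D w z = (Real.sqrt z.im : ℂ) * ∑' v : Fin 3 → ℤ, (genusWt D v : ℂ) *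
      shintaniFn w (mulPos (1 / (256 * D)) (scaleD_pos D) z) (latFun v) := by
  unfold kerD genKernel
  rw [tsum_cD_mul D _]

/-- **`K_D ≡ 0` for `D ≡ 3 (mod 4)`** (`D` odd square-free): the weight is even, the Schwartz
function odd. [folklore] -/
theorem kerD_eq_zero_of_mod_four {D : ℕ} [NeZero D] (hsq : Squarefree D) (hD : D % 4 = 3) (w z : ℍ) :
    kerD D w z = 0 := by
  have hodd : Odd D := Nat.odd_iff.mpr (by omega)
  have hχ : (ZMod.χ₄ (D : ZMod 4) : ℤ) = -1 := by
    rw [ZMod.χ₄_nat_mod_four, hD]; decide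
  have hs : ∀ k, cD D (-k) = (1 : ℂ) * cD D k := by
    intro k
    rw [one_mul]
    unfold cD
    simp only [Pi.neg_apply, dvd_neg]
    split_ifs with h
    · obtain ⟨k1, hk1⟩ := h
      have hq : (-k 1) / 128 = -(k 1 / 128) := by
        rw [hk1, ← mul_neg, Int.mul_ediv_cancel_left _ (by norm_num),
          Int.mul_ediv_cancel_left _ (by norm_num)]
      have e1 : (![(-k 0), (-k 1) / 128, (-k 2)] : Fin 3 → ℤ) = -![k 0, k 1 / 128, k 2] := by
        funext i; fin_cases i <;> simp [hq]
      rw [e1, genusWt_neg hsq hodd, hχ]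
      simp
    · rfl
  have := genKernel_of_weight_neg (bddWeight_cD D) hs (1 / (256 * D)) (scaleD_pos D) w z
  unfold kerD
  have h2 : (1 : ℂ) + 1 ≠ 0 := by norm_num
  exact (mul_eq_zero.mp this).resolve_left h2

/-! ### Pieces of the Poisson step -/

section Pieces

open Literature.NumberTheory.EllipticCurves.ModularForms (coe_smul_eq' det_eq_one'
  moebius_eq_sub_inv' im_denom_pos)

/-- `invFour` is an involution: `-1/(4 · (-1/(4W))) = W`. [folklore] -/
theorem invFour_invFour (W : ℍ) : invFour (invFour W) = W := by
  apply UpperHalfPlane.ext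
  rw [coe_invFour, coe_invFour]
  have hW : (W : ℂ) ≠ 0 := W.ne_zero
  field_simp

/-- The auxiliary point `W = 64N(cz + d)` (`N = cD`). [folklore] -/
def auxW (N c : ℕ) [NeZero N] [NeZero c] (d : ℤ) (z : ℍ) : ℍ :=
  ((64 * N * d : ℤ) : ℝ) +ᵥ mulPos (64 * N * c) (by
    have := Nat.pos_of_ne_zero (NeZero.ne N); have := Nat.pos_of_ne_zero (NeZero.ne c)
    positivity) z

/-- `coe_auxW` (auxiliary). [folklore] -/
theorem coe_auxW (N c : ℕ) [NeZero N] [NeZero c] (d : ℤ) (z : ℍ) :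
    ((auxW N c d z : ℍ) : ℂ) = 64 * N * ((c : ℂ) * z + d) := by
  rw [auxW, UpperHalfPlane.coe_vadd, coe_mulPos]
  push_cast
  ring

/-- `coe_invFour_auxW` (auxiliary). [folklore] -/
theorem coe_invFour_auxW (N c : ℕ) [NeZero N] [NeZero c] (d : ℤ) (z : ℍ) :
    ((invFour (auxW N c d z) : ℍ) : ℂ) = -1 / (256 * N * ((c : ℂ) * z + d)) := by
  rw [coe_invFour, coe_auxW]
  ring

/-- **The point identity** `(γz)/(256D) = a/(256Dc) + (-1/(256 N (cz+d)))`, `N = cD`, for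
`γ = (a b; c d) ∈ SL₂(ℤ)`, `c > 0`. [folklore] -/
theorem mulPos_smul_eq_vadd (D : ℕ) [NeZero D] (γ : SL(2, ℤ)) (c : ℕ) [NeZero c]
    (hc : (γ 1 0 : ℤ) = c) (z : ℍ) :
    mulPos (1 / (256 * D)) (scaleD_pos D) (γ • z) =
      ((γ 0 0 : ℤ) / (256 * D * c) : ℝ) +ᵥ invFour (auxW (c * D) c (γ 1 1) z) := by
  apply UpperHalfPlane.ext
  rw [coe_mulPos, UpperHalfPlane.coe_vadd, coe_invFour_auxW, coe_smul_eq' γ z, hc, Int.cast_natCast]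
  have hdet : ((γ 0 0 : ℤ) : ℂ) * (γ 1 1 : ℤ) - (γ 0 1 : ℤ) * (c : ℂ) = 1 := by
    have := det_eq_one' γ
    rw [hc] at this
    exact_mod_cast this
  have hcz : (c : ℂ) * z + (γ 1 1 : ℤ) ≠ 0 := by
    have := im_denom_pos (c := c) (γ 1 1) z
    intro h; rw [h] at this; simp at this
  have hc0 : (c : ℂ) ≠ 0 := by exact_mod_cast NeZero.ne c
  have hD0 : (D : ℂ) ≠ 0 := by exact_mod_cast NeZero.ne D
  rw [moebius_eq_sub_inv' hc0 hdet hcz]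
  push_cast
  field_simp
  ring

/-! #### Splitting `ℤ³` modulo `N` -/

/-- `ℤ³ ≃ ℤ³ × (ℤ/N)³`, `v = N q + r` with `0 ≤ r < N` coordinatewise. [folklore] -/
def splitEquiv (N : ℕ) [NeZero N] : (Fin 3 → ℤ) × (Fin 3 → ZMod N) ≃ (Fin 3 → ℤ) where
  toFun qr := fun i ↦ (N : ℤ) * qr.1 i + ((qr.2 i).val : ℤ)
  invFun v := (fun i ↦ v i / N, fun i ↦ (v i : ZMod N))
  left_inv qr := by
    obtain ⟨q, r⟩ := qr
    have hN : (0 : ℤ) < N := by exact_mod_cast Nat.pos_of_ne_zero (NeZero.ne N)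
    ext i
    · show ((N : ℤ) * q i + ((r i).val : ℤ)) / N = q i
      rw [add_comm, Int.add_mul_ediv_left _ _ hN.ne', Int.ediv_eq_zero_of_lt (by positivity)
        (by exact_mod_cast ZMod.val_lt (r i)), zero_add]
    · show (((N : ℤ) * q i + ((r i).val : ℤ) : ℤ) : ZMod N) = r i
      push_cast
      rw [ZMod.natCast_self, zero_mul, zero_add, ZMod.natCast_zmod_val]
  right_inv v := by
    funext i
    show (N : ℤ) * (v i / N) + (((v i : ZMod N)).val : ℤ) = v i
    rw [ZMod.val_intCast]
    exact Int.mul_ediv_add_emod (v i) N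

/-- `splitEquiv_apply` (auxiliary). [folklore] -/
theorem splitEquiv_apply (N : ℕ) [NeZero N] (q : Fin 3 → ℤ) (r : Fin 3 → ZMod N) (i : Fin 3) :
    splitEquiv N (q, r) i = (N : ℤ) * q i + ((r i).val : ℤ) := rfl

/-- The scaling vector `μ = (64N, 128N, N)`. [folklore] -/
def muN (N : ℕ) : Fin 3 → ℝ := ![64 * N, 128 * N, N]

/-- `one_le_muN` (auxiliary). [folklore] -/
theorem one_le_muN (N : ℕ) [NeZero N] (i : Fin 3) : 1 ≤ muN N i := by
  have : (1 : ℝ) ≤ N := by exact_mod_cast Nat.pos_of_ne_zero (NeZero.ne N)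
  fin_cases i
  · show (1 : ℝ) ≤ 64 * N; linarith
  · show (1 : ℝ) ≤ 128 * N; linarith
  · show (1 : ℝ) ≤ N; exact this

/-- `muN_prod` (auxiliary). [folklore] -/
theorem muN_prod (N : ℕ) : muN N 0 * muN N 1 * muN N 2 = 8192 * (N : ℝ) ^ 3 := by
  simp [muN]; ring

/-- `ι(Nq + r̃) = A q + ι(r̃)`, `A = diag(64N, 128N, N)`. [folklore] -/
theorem latFun_splitEquiv (N : ℕ) [NeZero N] (q : Fin 3 → ℤ) (r : Fin 3 → ZMod N) :
    latFun (splitEquiv N (q, r)) =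
      dgLin (muN N) (WithLp.toLp 2 fun i ↦ (q i : ℝ)) + latFun (liftZ r) := by
  ext i
  fin_cases i <;> simp [latFun, dgLin_apply, muN, splitEquiv_apply, liftZ] <;> ring

/-- `ω_D(Nq + r̃) = ω_D(r̃)` (`4 ∣ N`, `D ∣ N`). [folklore] -/
theorem genusWt_splitEquiv {D N : ℕ} [NeZero N] (h4 : 4 ∣ N) (hD : D ∣ N) (q : Fin 3 → ℤ)
    (r : Fin 3 → ZMod N) : genusWt D (splitEquiv N (q, r)) = genusWt D (liftZ r) := by
  refine genusWt_congr (M := N) (by exact_mod_cast h4) (by exact_mod_cast hD) fun i ↦ ?_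
  rw [splitEquiv_apply, liftZ]
  exact (Int.modEq_iff_dvd.mpr ⟨-q i, by ring⟩)

/-- `n(Nq + r̃) ≡ n(r̃) (mod N)`. [folklore] -/
theorem nQ_splitEquiv (N : ℕ) [NeZero N] (q : Fin 3 → ℤ) (r : Fin 3 → ZMod N) :
    ∃ m : ℤ, nQ (splitEquiv N (q, r)) = nQ (liftZ r) + N * m := by
  have h : nQ (splitEquiv N (q, r)) ≡ nQ (liftZ r) [ZMOD N] := by
    refine nQ_emod_congr fun i ↦ ?_
    rw [splitEquiv_apply, liftZ]
    exact (Int.modEq_iff_dvd.mpr ⟨-q i, by ring⟩)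
  obtain ⟨m, hm⟩ := Int.modEq_iff_dvd.mp h.symm
  exact ⟨m, by linear_combination hm⟩

/-! #### The dual side -/

/-- The sign-and-swap involution `m ↦ (-m₂, m₁, -m₀)` of `ℤ³`. [folklore] -/
def swapNeg (m : Fin 3 → ℤ) : Fin 3 → ℤ := ![-m 2, m 1, -m 0]

/-- `swapNeg_zero` (auxiliary). [folklore] -/
@[simp] theorem swapNeg_zero (m : Fin 3 → ℤ) : swapNeg m 0 = -m 2 := rfl
/-- `swapNeg_one` (auxiliary). [folklore] -/
@[simp] theorem swapNeg_one (m : Fin 3 → ℤ) : swapNeg m 1 = m 1 := rfl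
/-- `swapNeg_two` (auxiliary). [folklore] -/
@[simp] theorem swapNeg_two (m : Fin 3 → ℤ) : swapNeg m 2 = -m 0 := rfl

/-- `swapNeg_swapNeg` (auxiliary). [folklore] -/
theorem swapNeg_swapNeg (m : Fin 3 → ℤ) : swapNeg (swapNeg m) = m := by
  funext i; fin_cases i <;> simp [swapNeg]

/-- `swapNeg` as an equivalence. [folklore] -/
def swapNegEquiv : (Fin 3 → ℤ) ≃ (Fin 3 → ℤ) :=
  ⟨swapNeg, swapNeg, swapNeg_swapNeg, swapNeg_swapNeg⟩

/-- The dual lattice vector `B m = (m₀/(64N), m₁/(128N), m₂/N)`. [folklore] -/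
def dualVec (N : ℕ) (m : Fin 3 → ℤ) : V :=
  dgLin (fun i ↦ (muN N i)⁻¹) (WithLp.toLp 2 fun i ↦ (m i : ℝ))

/-- `dualVec_apply` (auxiliary). [folklore] -/
theorem dualVec_apply (N : ℕ) (m : Fin 3 → ℤ) (i : Fin 3) : dualVec N m i = (muN N i)⁻¹ * m i := by
  rw [dualVec, dgLin_apply]

/-- `sinv_smul` (auxiliary). [folklore] -/
theorem sinv_smul (t : ℝ) (x : V) : sinv (t • x) = t • sinv x := by
  ext i; fin_cases i <;> simp [sinv] <;> ring

/-- `(128N) · S⁻¹(B m) = ι♮(swapNeg m)`. [folklore] -/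
theorem smul_sinv_dualVec (N : ℕ) [NeZero N] (m : Fin 3 → ℤ) :
    ((128 * N : ℝ)) • sinv (dualVec N m) = latSharp (swapNeg m) := by
  have hN : (N : ℝ) ≠ 0 := by exact_mod_cast NeZero.ne N
  ext i
  fin_cases i <;> simp [sinv, dualVec_apply, muN, latSharp] <;> field_simp <;> ring

/-- `disc(S⁻¹(B m)) = disc(ι♮(swapNeg m))/(128N)²`. [folklore] -/
theorem disc_sinv_dualVec (N : ℕ) [NeZero N] (m : Fin 3 → ℤ) :
    disc (sinv (dualVec N m)) = disc (latSharp (swapNeg m)) / (128 * N) ^ 2 := by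
  have hN : (0 : ℝ) < 128 * N := by
    have : (0 : ℝ) < N := by exact_mod_cast Nat.pos_of_ne_zero (NeZero.ne N)
    positivity
  rw [← smul_sinv_dualVec N m, disc_smul, eq_div_iff (by positivity)]
  ring

/-- `⟪ι(r̃), B m⟫ = (r̃₀m₀ + r̃₁m₁ + r̃₂m₂)/N`. [folklore] -/
theorem inner_latFun_dualVec (N : ℕ) [NeZero N] (v m : Fin 3 → ℤ) :
    @inner ℝ V _ (latFun v) (dualVec N m) = ((v 0 * m 0 + v 1 * m 1 + v 2 * m 2 : ℤ) : ℝ) / N := by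
  have hN : (N : ℝ) ≠ 0 := by exact_mod_cast NeZero.ne N
  rw [inner_eq_sum_three]
  simp only [latFun_zero, latFun_one, latFun_two, dualVec_apply, muN]
  simp
  field_simp

/-! #### Exponentials of rational phases -/

/-- `e(x) = exp(2πi x)`. [folklore] -/
def eR (x : ℝ) : ℂ := cexp (2 * π * I * x)

/-- `eR_add` (auxiliary). [folklore] -/
theorem eR_add (x y : ℝ) : eR (x + y) = eR x * eR y := by
  unfold eR; push_cast; rw [mul_add, Complex.exp_add]

/-- `eR_int` (auxiliary). [folklore] -/
theorem eR_int (n : ℤ) : eR n = 1 := by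
  unfold eR
  have := Complex.exp_int_mul_two_pi_mul_I n
  rw [← this]; congr 1; push_cast; ring

/-- `eR_add_int` (auxiliary). [folklore] -/
theorem eR_add_int (x : ℝ) (n : ℤ) : eR (x + n) = eR x := by
  rw [eR_add, eR_int, mul_one]

/-- `norm_eR` (auxiliary). [folklore] -/
theorem norm_eR (x : ℝ) : ‖eR x‖ = 1 := by
  unfold eR
  rw [show (2 * π * I * x : ℂ) = ((2 * π * x : ℝ) : ℂ) * I by push_cast; ring, Complex.norm_exp_ofReal_mul_I]

/-- `e(j/N) = ψ_N(j)` (Mathlib's standard additive character of `ℤ/N`). [folklore] -/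
theorem eR_div_eq_stdAddChar (N : ℕ) [NeZero N] (j : ℤ) :
    eR (j / N) = ZMod.stdAddChar (j : ZMod N) := by
  rw [ZMod.stdAddChar_coe, eR]
  congr 1
  push_cast
  ring

/-! #### Homogeneity at the kernel's scale -/

variable (D : ℕ) [NeZero D]

/-- The `D`-th scale as a point map `z ↦ z/(256D)`. [folklore] -/
abbrev ptD (z : ℍ) : ℍ := mulPos (1 / (256 * D)) (scaleD_pos D) z

/-- `(128N)² / (256 D) = 64 N c` (`N = cD`), so `f_{w, z/(256D)}((128N) • y) = 128N · f_{w, 64Nc·z}(y)`.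
[folklore] -/
theorem shintaniFn_ptD_smul (c : ℕ) [NeZero c] (w z : ℍ) (y : V) :
    shintaniFn w (ptD D z) (((128 * (c * D : ℕ) : ℝ)) • y) =
      (128 * (c * D : ℕ) : ℝ) * shintaniFn w (mulPos (64 * (c * D : ℕ) * c) (by
        have := Nat.pos_of_ne_zero (NeZero.ne c); have := Nat.pos_of_ne_zero (NeZero.ne D)
        positivity) z) y := by
  have hpos : (0 : ℝ) < 128 * (c * D : ℕ) := by
    have := Nat.pos_of_ne_zero (NeZero.ne c); have := Nat.pos_of_ne_zero (NeZero.ne D)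
    positivity
  rw [shintaniFn_smul w (ptD D z) hpos y]
  congr 2
  rw [ptD, mulPos_mulPos]
  apply UpperHalfPlane.ext
  simp only [coe_mulPos]
  have hD : (D : ℂ) ≠ 0 := by exact_mod_cast NeZero.ne D
  push_cast
  field_simp
  ring

/-! #### The `q`-sum over a fixed residue class (Poisson, inversion, homogeneity, reindexing) -/

open scoped FourierTransform RealInnerProductSpace in
/-- Mathlib's Fourier character acting on `ℂ`: `𝐞(x) • w = e(x) w`. [folklore] -/
theorem fourierChar_smul_eq (x : ℝ) (w : ℂ) : 𝐞 x • w = eR x * w := by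
  rw [Circle.smul_def, Real.fourierChar_apply, smul_eq_mul, eR]
  congr 1
  push_cast
  ring_nf

/-- The value of `f_{w, W}` (`W = 64N(cz+d)`) at a dual vector, reduced to the kernel's own scale:
`f_{w,W}(S⁻¹Bm) = e(d·disc ι♮(k)/(256N)) · (128N)⁻¹ · f_{w, z/(256D)}(ι♮(k))`, `k = swapNeg m`. [folklore] -/
theorem shintaniFn_auxW_sinv_dualVec (c : ℕ) [NeZero c] (d : ℤ) (w z : ℍ) (m : Fin 3 → ℤ) :
    shintaniFn w (auxW (c * D) c d z) (sinv (dualVec (c * D) m)) =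
      eR (d * disc (latSharp (swapNeg m)) / (256 * (c * D : ℕ))) *
        (((128 * (c * D : ℕ) : ℝ) : ℂ)⁻¹ * shintaniFn w (ptD D z) (latSharp (swapNeg m))) := by
  have hN : (0 : ℝ) < (c * D : ℕ) := by exact_mod_cast Nat.pos_of_ne_zero (NeZero.ne (c * D))
  set y : V := sinv (dualVec (c * D) m) with hy
  -- translation part of `W`
  have h1 : shintaniFn w (auxW (c * D) c d z) y =
      cexp (2 * π * I * (((64 * (c * D : ℕ) * d : ℤ) : ℝ) * disc y)) *
        shintaniFn w (mulPos (64 * (c * D : ℕ) * c) (by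
          have := Nat.pos_of_ne_zero (NeZero.ne c); positivity) z) y := by
    unfold auxW
    rw [shintaniFn_vadd]
  -- homogeneity part
  have h2 := shintaniFn_ptD_smul D c w z y
  rw [hy, smul_sinv_dualVec] at h2
  rw [← hy] at h2
  have h128 : ((128 * (c * D : ℕ) : ℝ) : ℂ) ≠ 0 := by
    have : (0 : ℝ) < 128 * (c * D : ℕ) := by positivity
    exact_mod_cast this.ne'
  have h3 : shintaniFn w (mulPos (64 * (c * D : ℕ) * c) (by
          have := Nat.pos_of_ne_zero (NeZero.ne c); positivity) z) y =
      (((128 * (c * D : ℕ) : ℝ) : ℂ))⁻¹ * shintaniFn w (ptD D z) (latSharp (swapNeg m)) := by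
    rw [eq_inv_mul_iff_mul_eq₀ h128, ← h2]
  rw [h1, h3]
  congr 1
  -- the phase: `64Nd · disc(y) = d disc(ι♮ k)/(256N)`
  rw [eR, hy, disc_sinv_dualVec]
  congr 1
  push_cast
  field_simp
  ring

open scoped FourierTransform RealInnerProductSpace in
/-- **The `q`-sum over the residue class `r`**:
`∑_q f_{w,Z'}(Aq + ι(r̃)) = (8192N³)⁻¹ κ(Z') (128N)⁻¹ ∑_k e(ℓ(r̃,k)/N) e(d·disc ι♮(k)/(256N)) f_{w,z/(256D)}(ι♮ k)`,
`Z' = -1/(4W)`, `ℓ(r̃, k) = -r̃₀k₂ + r̃₁k₁ - r̃₂k₀`. [folklore] -/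
theorem tsum_q_residue (c : ℕ) [NeZero c] (d : ℤ) (w z : ℍ) (r : Fin 3 → ZMod (c * D)) :
    ∑' q : Fin 3 → ℤ, shintaniFn w (invFour (auxW (c * D) c d z))
        (dgLin (muN (c * D)) (WithLp.toLp 2 fun i ↦ (q i : ℝ)) + latFun (liftZ r)) =
      (((8192 * ((c * D : ℕ) : ℝ) ^ 3)⁻¹ : ℝ) : ℂ) * kappa (invFour (auxW (c * D) c d z)) *
        (((128 * (c * D : ℕ) : ℝ) : ℂ))⁻¹ *
        ∑' k : Fin 3 → ℤ,
          eR (((-(liftZ r 0) * k 2 + liftZ r 1 * k 1 - liftZ r 2 * k 0 : ℤ) : ℝ) / (c * D : ℕ)) *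
          eR (d * disc (latSharp k) / (256 * (c * D : ℕ))) *
          shintaniFn w (ptD D z) (latSharp k) := by
  rw [tsum_shintaniFn_diag (one_le_muN (c * D)) (latFun (liftZ r)) w (invFour (auxW (c * D) c d z)),
    invFour_invFour, muN_prod, Complex.real_smul]
  -- termwise
  have hterm : ∀ m : Fin 3 → ℤ,
      𝐞 (⟪latFun (liftZ r), dgLin (fun i ↦ (muN (c * D) i)⁻¹) (WithLp.toLp 2 fun i ↦ (m i : ℝ))⟫) •
        (kappa (invFour (auxW (c * D) c d z)) * shintaniFn w (auxW (c * D) c d z)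
          (sinv (dgLin (fun i ↦ (muN (c * D) i)⁻¹) (WithLp.toLp 2 fun i ↦ (m i : ℝ))))) =
      kappa (invFour (auxW (c * D) c d z)) * ((((128 * (c * D : ℕ) : ℝ) : ℂ))⁻¹ *
        (eR (((liftZ r 0 * m 0 + liftZ r 1 * m 1 + liftZ r 2 * m 2 : ℤ) : ℝ) / (c * D : ℕ)) *
          eR (d * disc (latSharp (swapNeg m)) / (256 * (c * D : ℕ))) *
          shintaniFn w (ptD D z) (latSharp (swapNeg m)))) := by
    intro m
    rw [fourierChar_smul_eq, show dgLin (fun i ↦ (muN (c * D) i)⁻¹) (WithLp.toLp 2 fun i ↦ (m i : ℝ)) =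
      dualVec (c * D) m from rfl, inner_latFun_dualVec, shintaniFn_auxW_sinv_dualVec]
    ring
  simp_rw [hterm]
  rw [tsum_mul_left, tsum_mul_left, ← mul_assoc, ← mul_assoc]
  congr 1
  -- reindex `m = swapNeg k`
  rw [← swapNegEquiv.tsum_eq]
  refine tsum_congr fun k ↦ ?_
  show eR (((liftZ r 0 * (swapNeg k) 0 + liftZ r 1 * (swapNeg k) 1 + liftZ r 2 * (swapNeg k) 2 : ℤ) : ℝ) /
      (c * D : ℕ)) * eR (d * disc (latSharp (swapNeg (swapNeg k))) / (256 * (c * D : ℕ))) *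
      shintaniFn w (ptD D z) (latSharp (swapNeg (swapNeg k))) = _
  rw [swapNeg_swapNeg, swapNeg_zero, swapNeg_one, swapNeg_two]
  congr 3
  push_cast
  ring

/-! ### The Gauss coefficients and the Poisson step -/

/-- `disc ι(v) = 256 n(v)`. [folklore] -/
theorem disc_latFun (v : Fin 3 → ℤ) : disc (latFun v) = 256 * (nQ v : ℝ) := by
  simp only [disc, latFun_zero, latFun_one, latFun_two, nQ]; push_cast; ring

/-- **The Gauss coefficient** of the transformed kernel:
`𝔊_γ(k) = e(d · disc ι♮(k)/(256N)) · ∑_{r ∈ (ℤ/N)³} ω_D(r) ψ_N(a n(r) + ℓ(r, k))`, `N = cD`. [folklore] -/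
def gaussCoef (a d : ℤ) (c : ℕ) [NeZero c] (h4 : 4 ∣ c * D) (k : Fin 3 → ℤ) : ℂ :=
  eR (d * disc (latSharp k) / (256 * (c * D : ℕ))) *
    ∑ r : Fin 3 → ZMod (c * D), wN D h4 r * ZMod.stdAddChar ((a : ZMod (c * D)) * nZ r + ellZ r k)

omit [NeZero D] in
/-- `|ω_D(r)| ≤ 1` on residues. [folklore] -/
theorem norm_wN_le {M : ℕ} [NeZero M] (h4 : 4 ∣ M) (r : Fin 3 → ZMod M) : ‖wN D h4 r‖ ≤ 1 := by
  unfold wN wD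
  rw [norm_mul]
  have h1 : ‖(((ZMod.χ₄ (ZMod.castHom h4 (ZMod 4) (r 2))) : ℤ) : ℂ)‖ ≤ 1 := by
    rw [← Complex.ofReal_intCast, Complex.norm_real, Real.norm_eq_abs]
    have := abs_χ₄_le ((ZMod.castHom h4 (ZMod 4) (r 2)).val : ℤ)
    have e : ((((ZMod.castHom h4 (ZMod 4) (r 2)).val : ℤ)) : ZMod 4) = ZMod.castHom h4 (ZMod 4) (r 2) := by
      rw [Int.cast_natCast, ZMod.natCast_zmod_val]
    rw [e] at this
    exact_mod_cast this
  have h2 : ‖((∏ p ∈ D.primeFactors, coneSymZ p fun i ↦ ((r i).cast : ZMod p) : ℤ) : ℂ)‖ ≤ 1 := by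
    rw [← Complex.ofReal_intCast, Complex.norm_real, Real.norm_eq_abs, Int.cast_prod, Finset.abs_prod]
    refine Finset.prod_le_one (fun _ _ ↦ abs_nonneg _) fun p _ ↦ ?_
    unfold coneSymZ
    exact_mod_cast abs_coneSym_le p _
  calc _ ≤ 1 * 1 := mul_le_mul h1 h2 (norm_nonneg _) zero_le_one
    _ = 1 := one_mul 1

/-- `|𝔊_γ(k)| ≤ N³`: the Gauss coefficients are bounded. [folklore] -/
theorem bddWeight_gaussCoef (a d : ℤ) (c : ℕ) [NeZero c] (h4 : 4 ∣ c * D) :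
    BddWeight (gaussCoef D a d c h4) := by
  refine ⟨(Fintype.card (Fin 3 → ZMod (c * D)) : ℝ), fun k ↦ ?_⟩
  unfold gaussCoef
  rw [norm_mul, norm_eR, one_mul]
  refine (norm_sum_le _ _).trans ?_
  have : ∀ r : Fin 3 → ZMod (c * D),
      ‖wN D h4 r * ZMod.stdAddChar ((a : ZMod (c * D)) * nZ r + ellZ r k)‖ ≤ 1 := fun r ↦ by
    rw [norm_mul, AddChar.norm_apply, mul_one]
    exact norm_wN_le D h4 r
  calc ∑ r : Fin 3 → ZMod (c * D), ‖wN D h4 r * ZMod.stdAddChar ((a : ZMod (c * D)) * nZ r + ellZ r k)‖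
      ≤ ∑ _r : Fin 3 → ZMod (c * D), (1 : ℝ) := Finset.sum_le_sum fun r _ ↦ this r
    _ = _ := by simp

open Literature.NumberTheory.LFunctions.Fourier (summable_one_add_norm_rpow_neg) in
omit [NeZero D] in
/-- Summability of the `L`-families `v ↦ ω_D(v) u(v) f_{w,Z}(ι v)` for bounded `u`. [folklore] -/
theorem summable_L_family (u : (Fin 3 → ℤ) → ℂ) (hu : ∀ v, ‖u v‖ ≤ 1) (w Z : ℍ) :
    Summable fun v : Fin 3 → ℤ ↦ (genusWt D v : ℂ) * u v * shintaniFn w Z (latFun v) := by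
  obtain ⟨C', hC'⟩ := norm_term_le (bddWeight_cD D) w Z
  refine Summable.of_norm_bounded ((summable_one_add_norm_rpow_neg (ι := Fin 3) (b := 4)
    (by norm_num)).mul_left C') fun v ↦ ?_
  have h := hC' (embedSharp v)
  rw [cD_embedSharp, latSharp_embedSharp] at h
  have hC0 : 0 ≤ C' := by
    have h0 := hC' 0
    have e0 : (fun i : Fin 3 ↦ (((0 : Fin 3 → ℤ) i : ℤ) : ℝ)) = 0 := by funext i; simp
    rw [e0, norm_zero, add_zero, Real.one_rpow, mul_one] at h0
    exact le_trans (norm_nonneg _) h0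
  calc ‖(genusWt D v : ℂ) * u v * shintaniFn w Z (latFun v)‖
      = ‖u v‖ * ‖(genusWt D v : ℂ) * shintaniFn w Z (latFun v)‖ := by
        rw [norm_mul, norm_mul, norm_mul]; ring
    _ ≤ 1 * (C' * (1 + ‖fun i ↦ ((embedSharp v i : ℤ) : ℝ)‖) ^ (-(4 : ℝ))) :=
        mul_le_mul (hu v) h (norm_nonneg _) zero_le_one
    _ ≤ 1 * (C' * (1 + ‖fun i ↦ ((v i : ℤ) : ℝ)‖) ^ (-(4 : ℝ))) := by
        refine mul_le_mul_of_nonneg_left (mul_le_mul_of_nonneg_left ?_ hC0) zero_le_one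
        · apply Real.rpow_le_rpow_of_nonpos (by positivity) ?_ (by norm_num)
          gcongr
          refine (pi_norm_le_iff_of_nonneg (norm_nonneg _)).mpr fun i ↦ ?_
          refine le_trans ?_ (norm_le_pi_norm (fun i ↦ ((embedSharp v i : ℤ) : ℝ)) i)
          rw [Real.norm_eq_abs, Real.norm_eq_abs]
          fin_cases i <;> simp [embedSharp, abs_mul]
          nlinarith [abs_nonneg ((v 1 : ℤ) : ℝ)]
    _ = _ := one_mul _

open Literature.NumberTheory.EllipticCurves.ModularForms (det_eq_one') in
/-- **The Poisson step.** For `γ = (a b; c d) ∈ SL₂(ℤ)` with `c > 0`, `4 ∣ c`, and `N = cD`: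
`K_D(w, γz) = (Im γz)^{1/2} (8192N³)⁻¹ κ(Z') (128N)⁻¹ ∑_{k ∈ ℤ³} 𝔊_γ(k) f_{w, z/(256D)}(ι♮(k))`,
`Z' = -1/(256N(cz+d))` (Shintani 1975, Prop. 1.6: Poisson summation over the classes of `L` modulo `N·L`,
then the inversion `z' ↦ -1/(4z')` and homogeneity). [cite: Shintani1975, Prop. 1.6] -/
theorem kerD_smul (γ : SL(2, ℤ)) (c : ℕ) [NeZero c] (hc : (γ 1 0 : ℤ) = c) (h4 : 4 ∣ c)
    (w z : ℍ) :
    kerD D w (γ • z) = (Real.sqrt (γ • z).im : ℂ) *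
      ((((8192 * ((c * D : ℕ) : ℝ) ^ 3)⁻¹ : ℝ) : ℂ) * kappa (invFour (auxW (c * D) c (γ 1 1) z)) *
        (((128 * (c * D : ℕ) : ℝ) : ℂ))⁻¹) *
      ∑' k : Fin 3 → ℤ, gaussCoef D (γ 0 0) (γ 1 1) c (dvd_mul_of_dvd_left h4 D) k *
        shintaniFn w (ptD D z) (latSharp k) := by
  set N : ℕ := c * D with hN
  set a : ℤ := γ 0 0 with ha
  set d : ℤ := γ 1 1 with hd
  have h4N : 4 ∣ c * D := dvd_mul_of_dvd_left h4 D
  have hDN : D ∣ c * D := dvd_mul_left D c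
  have hNpos : (0 : ℝ) < (c * D : ℕ) := by exact_mod_cast Nat.pos_of_ne_zero (NeZero.ne (c * D))
  set Z' : ℍ := invFour (auxW (c * D) c d z) with hZ'
  rw [kerD_eq_tsum, mul_assoc]
  congr 1
  -- Step A: the point identity and the phase `e(a n(v)/N)`
  have hP : ptD D (γ • z) = ((a / (256 * D * c) : ℝ)) +ᵥ Z' := mulPos_smul_eq_vadd D γ c hc z
  have hA : ∀ v : Fin 3 → ℤ, (genusWt D v : ℂ) * shintaniFn w (ptD D (γ • z)) (latFun v) =
      (genusWt D v : ℂ) * eR (a * nQ v / (c * D : ℕ)) * shintaniFn w Z' (latFun v) := by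
    intro v
    rw [hP, shintaniFn_vadd, disc_latFun, eR]
    conv_rhs => rw [mul_assoc]
    congr 2
    congr 1
    have hc0 : (c : ℂ) ≠ 0 := by exact_mod_cast NeZero.ne c
    have hD0 : (D : ℂ) ≠ 0 := by exact_mod_cast NeZero.ne D
    push_cast
    field_simp
  simp_rw [hA]
  -- Step B: reindex `v = Nq + r̃`
  set F : (Fin 3 → ℤ) → ℂ := fun v ↦ (genusWt D v : ℂ) * eR (a * nQ v / (c * D : ℕ)) *
    shintaniFn w Z' (latFun v) with hF
  have hFs : Summable F := summable_L_family D (fun v ↦ eR (a * nQ v / (c * D : ℕ)))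
    (fun v ↦ (norm_eR _).le) w Z'
  set e : (Fin 3 → ZMod N) × (Fin 3 → ℤ) ≃ (Fin 3 → ℤ) :=
    (Equiv.prodComm _ _).trans (splitEquiv N) with he
  have he_apply : ∀ r q, e (r, q) = splitEquiv N (q, r) := fun r q ↦ rfl
  have hFe : Summable (F ∘ e) := (e.summable_iff).mpr hFs
  rw [show ∑' v, F v = ∑' p : (Fin 3 → ZMod N) × (Fin 3 → ℤ), (F ∘ e) p from (e.tsum_eq F).symm,
    hFe.tsum_prod' (fun r ↦ hFe.prod_factor r), tsum_fintype]
  simp only [Function.comp_apply]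
  -- Step C: each residue class
  have hC : ∀ r : Fin 3 → ZMod N, ∑' q : Fin 3 → ℤ, F (e (r, q)) =
      (genusWt D (liftZ r) : ℂ) * eR (a * nQ (liftZ r) / (c * D : ℕ)) *
        ((((8192 * ((c * D : ℕ) : ℝ) ^ 3)⁻¹ : ℝ) : ℂ) * kappa Z' * (((128 * (c * D : ℕ) : ℝ) : ℂ))⁻¹ *
        ∑' k : Fin 3 → ℤ,
          eR (((-(liftZ r 0) * k 2 + liftZ r 1 * k 1 - liftZ r 2 * k 0 : ℤ) : ℝ) / (c * D : ℕ)) *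
          eR (d * disc (latSharp k) / (256 * (c * D : ℕ))) *
          shintaniFn w (ptD D z) (latSharp k)) := by
    intro r
    have h1 : ∀ q, F (e (r, q)) = (genusWt D (liftZ r) : ℂ) * eR (a * nQ (liftZ r) / (c * D : ℕ)) *
        shintaniFn w Z' (dgLin (muN N) (WithLp.toLp 2 fun i ↦ (q i : ℝ)) + latFun (liftZ r)) := by
      intro q
      rw [he_apply, hF]
      dsimp only
      rw [genusWt_splitEquiv h4N hDN, latFun_splitEquiv]
      obtain ⟨m, hm⟩ := nQ_splitEquiv N q r
      rw [hm]
      congr 2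
      push_cast
      have hNR : (N : ℝ) = (c : ℝ) * D := by rw [hN]; push_cast; ring
      have hc0 : (c : ℝ) ≠ 0 := by exact_mod_cast NeZero.ne c
      have hD0 : (D : ℝ) ≠ 0 := by exact_mod_cast NeZero.ne D
      have : (a : ℝ) * ((nQ (liftZ r) : ℝ) + (N : ℝ) * m) / ((c : ℝ) * D) =
          (a : ℝ) * (nQ (liftZ r)) / ((c : ℝ) * D) + ((a * m : ℤ) : ℝ) := by
        rw [hNR]; push_cast; field_simp
      rw [this, eR_add_int]
    simp_rw [h1]
    rw [tsum_mul_left, tsum_q_residue D c d w z r]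
  simp_rw [hC]
  -- Step D: swap the finite `r`-sum and the `k`-sum, collect `𝔊`
  have hk_summ : ∀ r : Fin 3 → ZMod N, Summable fun k : Fin 3 → ℤ ↦
      eR (((-(liftZ r 0) * k 2 + liftZ r 1 * k 1 - liftZ r 2 * k 0 : ℤ) : ℝ) / (c * D : ℕ)) *
      eR (d * disc (latSharp k) / (256 * (c * D : ℕ))) * shintaniFn w (ptD D z) (latSharp k) := by
    intro r
    have := summable_term (c := fun k ↦
      eR (((-(liftZ r 0) * k 2 + liftZ r 1 * k 1 - liftZ r 2 * k 0 : ℤ) : ℝ) / (c * D : ℕ)) *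
      eR (d * disc (latSharp k) / (256 * (c * D : ℕ)))) ⟨1, fun k ↦ by
        rw [norm_mul, norm_eR, norm_eR, one_mul]⟩ w (ptD D z)
    exact this
  -- the per-`(r, k)` identity: `ω(r̃) e(a n(r̃)/N) e(ℓ(r̃,k)/N) = ω_D(r) ψ_N(a n(r) + ℓ(r,k))`
  have hrk : ∀ (r : Fin 3 → ZMod N) (k : Fin 3 → ℤ),
      (genusWt D (liftZ r) : ℂ) * eR (a * nQ (liftZ r) / (c * D : ℕ)) *
        eR (((-(liftZ r 0) * k 2 + liftZ r 1 * k 1 - liftZ r 2 * k 0 : ℤ) : ℝ) / (c * D : ℕ)) =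
      wN D h4N r * ZMod.stdAddChar ((a : ZMod (c * D)) * nZ r + ellZ r k) := by
    intro r k
    rw [mul_assoc, ← eR_add, genusWt_eq_wN h4N hDN (liftZ r)]
    have hl : ∀ i, (((liftZ r i : ℤ)) : ZMod (c * D)) = r i := fun i ↦ by
      rw [liftZ, Int.cast_natCast, ZMod.natCast_zmod_val]
    congr 1
    · congr 1; funext i; exact hl i
    · rw [show (a : ℝ) * (nQ (liftZ r) : ℝ) / (c * D : ℕ) +
          ((-(liftZ r 0) * k 2 + liftZ r 1 * k 1 - liftZ r 2 * k 0 : ℤ) : ℝ) / (c * D : ℕ) =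
          ((a * nQ (liftZ r) + (-(liftZ r 0) * k 2 + liftZ r 1 * k 1 - liftZ r 2 * k 0) : ℤ) : ℝ) /
            (c * D : ℕ) by push_cast; ring, eR_div_eq_stdAddChar]
      congr 1
      unfold nQ nZ ellZ
      push_cast
      rw [hl 0, hl 1, hl 2]
      ring
  -- Step D: swap the finite `r`-sum with the `k`-sum and collect `𝔊`
  set C : ℂ := (((8192 * ((c * D : ℕ) : ℝ) ^ 3)⁻¹ : ℝ) : ℂ) * kappa Z' *
    (((128 * (c * D : ℕ) : ℝ) : ℂ))⁻¹ with hCdef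
  set A : (Fin 3 → ZMod N) → (Fin 3 → ℤ) → ℂ := fun r k ↦
    eR (((-(liftZ r 0) * k 2 + liftZ r 1 * k 1 - liftZ r 2 * k 0 : ℤ) : ℝ) / (c * D : ℕ)) *
      eR (d * disc (latSharp k) / (256 * (c * D : ℕ))) * shintaniFn w (ptD D z) (latSharp k) with hAdef
  set ω : (Fin 3 → ZMod N) → ℂ := fun r ↦ (genusWt D (liftZ r) : ℂ) * eR (a * nQ (liftZ r) / (c * D : ℕ))
    with hωdef
  show ∑ r : Fin 3 → ZMod N, ω r * (C * ∑' k, A r k) = C * ∑' k, gaussCoef D a d c h4N k *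
    shintaniFn w (ptD D z) (latSharp k)
  calc ∑ r : Fin 3 → ZMod N, ω r * (C * ∑' k, A r k)
      = C * ∑ r : Fin 3 → ZMod N, ∑' k, ω r * A r k := by
        rw [Finset.mul_sum]
        refine Finset.sum_congr rfl fun r _ ↦ ?_
        rw [tsum_mul_left]; ring
    _ = C * ∑' k, ∑ r : Fin 3 → ZMod N, ω r * A r k := by
        rw [Summable.tsum_finsetSum (fun r _ ↦ (hk_summ r).mul_left (ω r))]
    _ = C * ∑' k, gaussCoef D a d c h4N k * shintaniFn w (ptD D z) (latSharp k) := by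
        congr 1
        refine tsum_congr fun k ↦ ?_
        rw [gaussCoef, Finset.mul_sum, Finset.sum_mul]
        refine Finset.sum_congr rfl fun r _ ↦ ?_
        rw [hωdef, hAdef]
        dsimp only
        rw [← hrk r k]
        ring

end Pieces

/-! ### Evaluation at `c = 256`: the kernel reproduces itself -/

section Eval256

variable (D : ℕ) [NeZero D]

omit [NeZero D] in
/-- `4 ∣ 256 D`. [folklore] -/
theorem four_dvd_256_mul : 4 ∣ 256 * D := dvd_mul_of_dvd_left (by norm_num) D

/-- Off `L` the Gauss coefficient vanishes (`c = 256`). [folklore] -/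
theorem gaussCoef_of_not_dvd (a d : ℤ) {k : Fin 3 → ℤ} (hk : ¬ (128 : ℤ) ∣ k 1) :
    gaussCoef D a d 256 (four_dvd_256_mul D) k = 0 := by
  unfold gaussCoef
  rw [show ((a : ℤ) : ZMod (256 * D)) = (a : ZMod (256 * D)) from rfl,
    sum_wN_mul_stdAddChar_eq_zero (four_dvd_256_mul D) (a : ZMod (256 * D)) k hk, mul_zero]

/-- `ℓ(r, embed v) = B(r, v mod N)`. [folklore] -/
theorem ellZ_embedSharp {M : ℕ} (r : Fin 3 → ZMod M) (v : Fin 3 → ℤ) :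
    ellZ r (embedSharp v) = bZ r (fun i ↦ (v i : ZMod M)) := by
  simp only [ellZ, bZ, embedSharp_zero, embedSharp_one, embedSharp_two]
  push_cast
  ring

/-- The constant of the `c = 256` evaluation:
`𝒦(a, a*) = χ₄(-a*) J(-a* | D) · N · G(64a; N)`, `N = 256D`, `aa* ≡ 1 (mod N)`. [folklore] -/
def evalConst (a a' : ℤ) : ℂ :=
  ((ZMod.χ₄ (-a' : ℤ) : ℤ) : ℂ) * jacobiSym (-a') D * (256 * D : ℕ) *
    Literature.NumberTheory.EllipticCurves.ModularForms.quadGaussSum (256 * D) (64 * (a : ZMod (256 * D))) 0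

/-- **On `L` the Gauss coefficient reproduces the weight** (`c = 256`, `D` odd square-free,
`aa* ≡ 1 (mod 256D)`, `d ≡ a* (mod 256)`): `𝔊_σ(embed v) = 𝒦(a,a*) ω_D(v)`. [folklore] -/
theorem gaussCoef_embedSharp (hsq : Squarefree D) (hodd : Odd D) (a a' d : ℤ)
    (haa' : (a : ZMod (256 * D)) * (a' : ZMod (256 * D)) = 1) (hda : (256 : ℤ) ∣ d - a') (v : Fin 3 → ℤ) :
    gaussCoef D a d 256 (four_dvd_256_mul D) (embedSharp v) = evalConst D a a' * genusWt D v := by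
  have h4 := four_dvd_256_mul D
  have hDN : D ∣ 256 * D := dvd_mul_left D 256
  unfold gaussCoef
  simp_rw [ellZ_embedSharp]
  rw [sum_wN_mul_stdAddChar_bZ hsq hodd h4 (a : ZMod (256 * D)) (a' : ZMod (256 * D)) haa'
    (fun i ↦ (v i : ZMod (256 * D)))]
  -- the weight at `-(a* • v)`
  have hw : wN D h4 (-((a' : ZMod (256 * D)) • fun i ↦ (v i : ZMod (256 * D)))) =
      ((ZMod.χ₄ (-a' : ℤ) : ℤ) : ℂ) * jacobiSym (-a') D * genusWt D v := by
    have e : (-((a' : ZMod (256 * D)) • fun i ↦ (v i : ZMod (256 * D)))) =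
        fun i ↦ ((((-a') • v) i : ℤ) : ZMod (256 * D)) := by
      funext i; simp [Pi.smul_apply, smul_eq_mul]
    rw [e, ← genusWt_eq_wN h4 hDN, genusWt_smul hsq]
    push_cast
    ring
  rw [hw, latSharp_embedSharp, disc_latFun]
  -- the phases: `e(d·256 n(v)/(256N)) ψ_N(-a* n(v)) = ψ_N((d - a*) n(v)) = 1` on the support of `ω_D`
  by_cases hv : genusWt D v = 0
  · simp [hv]
  · have hDn : (D : ℤ) ∣ nQ v := by
      by_contra h; exact hv (genusWt_of_not_dvd hsq h)
    have hphase : eR (d * (256 * (nQ v : ℝ)) / (256 * (256 * D : ℕ))) *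
        (ZMod.stdAddChar (-((a' : ZMod (256 * D)) * nZ fun i ↦ (v i : ZMod (256 * D)))) : ℂ) = 1 := by
      have e1 : (d : ℝ) * (256 * (nQ v : ℝ)) / (256 * (256 * D : ℕ)) = ((d * nQ v : ℤ) : ℝ) / (256 * D : ℕ) := by
        have : ((256 * D : ℕ) : ℝ) ≠ 0 := by exact_mod_cast NeZero.ne (256 * D)
        push_cast; field_simp
      have e2 : (nZ fun i ↦ (v i : ZMod (256 * D))) = ((nQ v : ℤ) : ZMod (256 * D)) := by
        unfold nZ nQ; push_cast; ring
      rw [e1, eR_div_eq_stdAddChar, e2, ← AddChar.map_add_eq_mul]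
      have : ((d * nQ v : ℤ) : ZMod (256 * D)) + -((a' : ZMod (256 * D)) * ((nQ v : ℤ) : ZMod (256 * D))) = 0 := by
        obtain ⟨m, hm⟩ := hDn
        obtain ⟨e, he⟩ := hda
        have : (d * nQ v - a' * nQ v : ℤ) = (256 * D : ℕ) * (e * m) := by
          rw [← sub_mul, he, hm]; push_cast; ring
        have h0 : ((d * nQ v - a' * nQ v : ℤ) : ZMod (256 * D)) = 0 := by
          rw [this, Int.cast_mul, Int.cast_natCast, ZMod.natCast_self, zero_mul]
        push_cast at h0 ⊢
        linear_combination h0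
      rw [this, AddChar.map_zero_eq_one]
    unfold evalConst
    linear_combination (((ZMod.χ₄ (-a' : ℤ) : ℤ) : ℂ) * jacobiSym (-a') D * genusWt D v * (256 * D : ℕ) *
      Literature.NumberTheory.EllipticCurves.ModularForms.quadGaussSum (256 * D)
        (64 * (a : ZMod (256 * D))) 0) * hphase

/-- A series of Gauss coefficients against `ι♮` collapses to the weight series against `ι`. [folklore] -/
theorem tsum_gaussCoef_mul (hsq : Squarefree D) (hodd : Odd D) (a a' d : ℤ)
    (haa' : (a : ZMod (256 * D)) * (a' : ZMod (256 * D)) = 1) (hda : (256 : ℤ) ∣ d - a')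
    (F : V → ℂ) :
    ∑' k : Fin 3 → ℤ, gaussCoef D a d 256 (four_dvd_256_mul D) k * F (latSharp k) =
      evalConst D a a' * ∑' v : Fin 3 → ℤ, (genusWt D v : ℂ) * F (latFun v) := by
  have hsupp : Function.support (fun k : Fin 3 → ℤ ↦ gaussCoef D a d 256 (four_dvd_256_mul D) k *
      F (latSharp k)) ⊆ Set.range embedSharp := by
    intro k hk
    rw [Function.mem_support] at hk
    by_cases h : (128 : ℤ) ∣ k 1
    · obtain ⟨k1, hk1⟩ := h
      exact ⟨![k 0, k1, k 2], by funext i; fin_cases i <;> simp [embedSharp, hk1]⟩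
    · exact absurd (by rw [gaussCoef_of_not_dvd D a d h, zero_mul]) hk
  rw [← tsum_subtype_eq_of_support_subset hsupp,
    ← (Equiv.ofInjective embedSharp embedSharp_injective).tsum_eq, ← tsum_mul_left]
  refine tsum_congr fun v ↦ ?_
  simp only [Equiv.ofInjective_apply]
  rw [gaussCoef_embedSharp D hsq hodd a a' d haa' hda, latSharp_embedSharp]
  ring

/-- **The kernel reproduces itself under `σ = (a b; 256 d)`** (`D` odd square-free, `aa* ≡ 1 (mod 256D)`):
`K_D(w, σz) = (Im σz)^{1/2} (8192N³)⁻¹ κ(Z') (128N)⁻¹ 𝒦(a,a*) (Im z)^{-1/2} K_D(w, z)`. [folklore] -/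
theorem kerD_smul_sigma (hsq : Squarefree D) (hodd : Odd D) (σ : SL(2, ℤ)) (hc : (σ 1 0 : ℤ) = 256)
    (a' : ℤ) (haa' : ((σ 0 0 : ℤ) : ZMod (256 * D)) * (a' : ZMod (256 * D)) = 1) (w z : ℍ) :
    kerD D w (σ • z) = (Real.sqrt (σ • z).im : ℂ) *
      ((((8192 * ((256 * D : ℕ) : ℝ) ^ 3)⁻¹ : ℝ) : ℂ) * kappa (invFour (auxW (256 * D) 256 (σ 1 1) z)) *
        (((128 * (256 * D : ℕ) : ℝ) : ℂ))⁻¹) *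
      (evalConst D (σ 0 0) a' * ((Real.sqrt z.im : ℂ))⁻¹ * kerD D w z) := by
  have hda : (256 : ℤ) ∣ (σ 1 1 : ℤ) - a' := by
    -- `a d ≡ 1 (mod 256)` and `a a* ≡ 1 (mod 256)`, `a` odd
    have hdet := Literature.NumberTheory.EllipticCurves.ModularForms.det_eq_one' σ
    rw [hc] at hdet
    have h1 : ((σ 0 0 : ℤ) : ZMod 256) * ((σ 1 1 : ℤ) : ZMod 256) = 1 := by
      have := congrArg (fun x : ℤ ↦ (x : ZMod 256)) hdet
      push_cast at this
      have h256 : (256 : ZMod 256) = 0 := by decide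
      rw [h256, mul_zero, sub_zero] at this
      exact this
    have h2 : ((σ 0 0 : ℤ) : ZMod 256) * ((a' : ℤ) : ZMod 256) = 1 := by
      have := congrArg (ZMod.castHom (dvd_mul_right 256 D) (ZMod 256)) haa'
      rw [map_mul, map_one, map_intCast, map_intCast] at this
      exact this
    have hu : IsUnit ((σ 0 0 : ℤ) : ZMod 256) := IsUnit.of_mul_eq_one _ h1
    have h3 : ((σ 1 1 : ℤ) : ZMod 256) = ((a' : ℤ) : ZMod 256) := by
      have := hu.mul_left_cancel (h1.trans h2.symm)
      exact this
    have h4 : (((σ 1 1 : ℤ) - a' : ℤ) : ZMod 256) = 0 := by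
      push_cast
      rw [h3, sub_self]
    exact_mod_cast (ZMod.intCast_zmod_eq_zero_iff_dvd _ 256).mp h4
  haveI : NeZero (256 : ℕ) := ⟨by norm_num⟩
  rw [kerD_smul D σ 256 hc (by norm_num) w z]
  congr 1
  rw [tsum_gaussCoef_mul D hsq hodd (σ 0 0) a' (σ 1 1) haa' hda _, kerD_eq_tsum]
  have hz : (Real.sqrt z.im : ℂ) ≠ 0 := by
    exact_mod_cast (Real.sqrt_pos.mpr z.im_pos).ne'
  field_simp

end Eval256

end Literature.NumberTheory.EllipticCurves.Shintani
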